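import Summits.Parity.GeneralizedHardyLittlewood.Theorems.PrimeLevelFamEdgeIdeaDeltasShortWindowDefs
import Literature.NumberTheory.LFunctions.GallagherDirichletPolynomial
import HarnessLib

/-!
# Route `PrimeLevelFamEdge` — TYPED IDEA DELTAS, deck 27b: the short-window funder's Gallagher input is a THEOREM
# (cell ls-idea, D-0159 U-WAVE, critic B's P-B203-1; typer ls-idea-typ-1 gen 4)

Deck 27 (`…ShortWindowDefs`) typed critic B's funder candidate for U ≡ L5′ of K_B = stmt-Parity-20343 with THREE inputs:
`ShortWindow.GallagherDirichlet` (Gallagher 1970 Lemma 1, multiplicative form — «not in the tree», B b205),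
`ShortWindow.MobiusShortIntervals` (Möbius in short intervals, print to be placed by critic C) and the pencil
`ShortWindow.StatementOfGallagher`.  This deck DISCHARGES the first: `GallagherDirichlet` holds, by the kernel proof of
Gallagher's lemma for arbitrary real frequencies landed under `Literature/NumberTheory/LFunctions/`
(`GallagherFejerKernel.lean`: `𝓕Δ_δ = K_δ`, Fourier inversion, Jordan floor; `GallagherShortWindowMeanValue.lean`:
`∫_{-T}^{T}|S|² ≤ (π²/4δ²)·∑ c_i c̄_j Δ_δ(ν_i − ν_j) = (π²/4δ²)∫|window sums|²`, which also discharges the tree's named fact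
`MontgomeryVaughan1975.lemma42_gallagher`; `GallagherDirichletPolynomial.lean`: the instance `ν_n = −log n/(2π)`,
`δ = 1/(2πT)`, constant `π³/2`).  After this deck the funder's named inputs are `MobiusShortIntervals` + the pencil
`StatementOfGallagher` + the Archimedean steps (α)/(β) of the desk's U-WAVE amendment 1.

HONESTY. No exceptional-zero theorem (no Landau–Siegel / Siegel-zero exclusion, no Theorem 1–2 of arXiv:2211.02515,
no repaired Margin232) is proved here; nothing below bounds any dual term of `stub_offDiagBelowSlack_io`; a discharged
INPUT of a candidate funder is not the funder; typed ≠ proved for everything except the theorem below.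
-/

namespace Summit.Parity.GeneralizedHardyLittlewood.Theorems.PrimeLevelFamEdgeIdeaDeltas.ShortWindow

/-- **`GallagherDirichlet` HOLDS** (critic B's hypothesis = Gallagher 1970 Lemma 1 for `∑ a_n n^{-it}` with windows
`(y, e^{1/T}y]`, constant `C = π³/2`): the tree theorem
`Literature.NumberTheory.LFunctions.Gallagher.gallagher_dirichlet`, whose statement is this `Prop` verbatim. -/
theorem gallagherDirichlet_holds : GallagherDirichlet :=
  Literature.NumberTheory.LFunctions.Gallagher.gallagher_dirichlet

/-- Hence the pencil `StatementOfGallagher` alone yields the short-window `Statement θ` on `[1/2, 1)`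
(bookkeeping: one named input fewer). -/
theorem statement_of_statementOfGallagher (h : StatementOfGallagher) {θ : ℝ} (hθ : 1 / 2 ≤ θ) (hθ' : θ < 1) :
    Statement θ :=
  h gallagherDirichlet_holds θ hθ hθ'

end Summit.Parity.GeneralizedHardyLittlewood.Theorems.PrimeLevelFamEdgeIdeaDeltas.ShortWindow
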